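/-
COR-CM (cell pub-hodgecm2, stage 2 of the Hodge ladder) — count-neutral KERNEL NORMAL FORMS of the displayed leaf B01-S
`Universe.FaceSupply` (`CorCM/B01/FaceInputsSplit.lean` :50, p252201) on the model universe of record: the FACE drops out of
B01-S.  Seat prover-pub-hodgecm2-b07-g32-0 (binder prover b07, gen 32; claim SUPPLY-NF, HOME/lit/LIT-STATUS.md 2026-08-21T08:33Z),
sequel of `CorCM/UisoLevelMonotone.lean` (p255329, UISO-LEVEL).  Theorems only: no definition, no named fact, nothing asserted;
nothing under `CorCM/B01/` is edited (its declarations are imported BY NAME); `Interfaces.lean` (C1) untouched.  The reverse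
(«deflation») inclusion of `Model.universeOf_uisoInflation`, staged by prover-pub-hodgecm2-b01-g42-0 for the owner of `CorCM/B01/`,
is NOT restated here; only the landed inflation inclusion is used.
-/
import Summits.HodgeConjecture.CorCM.UisoLevelMonotone
import Summits.HodgeConjecture.CorCM.B01.FaceSupplyAlbanese
import Summits.HodgeConjecture.CorCM.B01.UisoInflationRec
import Literature.NumberTheory.ComplexMultiplication.CMTypeInducedFromPrimitive
import HarnessLib

/-!
# B01-S on the model universe is face-free: every CM type containing `ι₁` must be supplied

`U.FaceSupply` (B01-S) asks, for every Galois CM field `F` with `6 ≤ [F:ℚ]`, every rank-four face `f = (Φ; π, π′)` of `F`,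
every admissible `ι₁` and every hermitian 3-space `V` of signature `(2,1)` at `ι₁`, for ONE level `Γ` carrying non-zero
classes of the two isotypic blocks `U_{Ψ₀}(Γ)_{ι₁}`, `U_{Ψ₁}(Γ)_{ι₁}` of the slot types `Ψ₀ = f.psi 0 = Φ`,
`Ψ₁ = f.psi 1 = Φ^{(ππ′)}`.

1. `exists_face_eq_admissible` — with three infinite places (`6 ≤ [F:ℚ]`) EVERY CM type `Φ ∋ ι₁` is the base type `f.Φ = f.psi 0`
   of a face admissible at `ι₁` (choose `π ≠ π′` off the place of `ι₁`).  Hence, on ANY universe, B01-S supplies every CM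
   type containing `ι₁` (`Universe.exists_mem_Uiso_ne_zero_of_faceSupply`): the face imposes no restriction on slot 0.
2. `Model.faceSupply_iff_typewise` — on `U = picardCMUniverse hHD hI h₁ h₃` (and on `universeOf hHD hI hU h₃` for any packaged
   uniformisation datum), definition-free:
   `U.FaceSupply ↔ ∀ F Galois, 6 ≤ [F:ℚ], ∀ (Φ : CMType F) (ι₁ ∈ Φ) (V : HermSpace3 F ι₁), ∃ Γ ω, ω ∈ U.Uiso Γ F Φ ι₁ ∧ ω ≠ 0`.
   The converse direction is the level-joining of `Model.faceSupply_iff_slotwise` (supply is monotone in the level, so the two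
   slot supplies — both instances of the face-free statement, `admissible_mem_psi` — meet at `Γ₀ ⊓ Γ₁`).
3. `Model.faceSupply_iff_typeReach` — the same at the level of MORPHISMS («isotypicity is free», own-b01's
   `Universe.Uiso_ne_bot_iff` over the rows `Fact_H1_rank`/`Fact_eigenLine`/`Fact_alphaLine`, all tree theorems on the model):
   `U.FaceSupply ↔ ∀ F Φ ι₁ ∈ Φ, V, ∃ Γ (u : U.Mor (U.pms F ι₁ V Γ) (U.cmAV F Φ)), U.pull u 1 ≠ 0` — every CM abelian variety
   `A_{(F,Φ)}` with `ι₁ ∈ Φ` is a target, non-zero on `H¹`, of SOME compact Picard modular surface of the `V`-tower.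
4. `Model.faceSupply_of_primitiveReach` — **reaching the primitive cores suffices**: if for every PRIMITIVE sub-pair
   `(K₀ →ᵏ F, Φ₀)` (primitivity in the `Aut(ℂ)`-pattern form of `CMTypeInducedFromPrimitive`, Streng 2010 Lemma 3.5) with
   `ι₁ ∘ k ∈ Φ₀` some `P_Γ(V) → A_{(K₀,Φ₀)}` is non-zero on `H¹`, then B01-S holds — by the existence of the primitive core
   (`exists_primitive_inducedCMType_eq_of_isCMField`), the inflation inclusion `U_{(K₀,Φ₀)}(Γ)_{ι₁∘k} ≤ U_{(F,Φ₀^F)}(Γ)_{ι₁}`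
   (`Model.universeOf_uisoInflation`) and 3.  (The converse is the reverse inclusion; it is not proved in this file.)

Reading.  B01-S is therefore the statement «for every CM type `Φ` of `F` containing `ι₁` (equivalently: for the simple CM abelian
variety of its primitive core), some surface of the `V`-tower maps to `A_Φ` non-trivially on `H¹`» — one CM type at a time, no face,
no common level, no eigen-class.  This is the shape in which a print anchor (non-vanishing of theta lifts of Hecke characters of
a given CM type to `U(V)`; CM factors of the Albanese varieties of compact Picard modular surfaces) is to be matched; nothing displayed
changes, and whether B01-S is re-cut in this shape is the call of the owner of `CorCM/B01/`.

References: M. Streng, *Complex multiplication of abelian surfaces* (2010) Ch. I Lemma 3.5 (primitive sub-pair);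
G. Shimura, *Abelian Varieties with Complex Multiplication and Modular Functions* (1998) §6.2 Thm. 3, §8.2 Prop. 26
(inflation `A_{(F,Φ₀^F)} ~ A_{(K₀,Φ₀)}^{[F:K₀]}`); N. Bergeron, J. Millson, C. Moeglin, Acta Math. 216 (2016), Introduction §1.1
(the congruence tower of compact ball quotients).
-/

noncomputable section

open scoped TensorProduct
open NumberField
open Literature.AlgebraicGeometry.Motives (CMType)
open Literature.AlgebraicGeometry.HodgeTheory
open Literature.NumberTheory.Automorphic.PicardCM
open Literature.NumberTheory.ComplexMultiplication (inducedCMType mem_inducedCMType_iff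
  exists_primitive_inducedCMType_eq_of_isCMField)

namespace Summit.HodgeConjecture.CorCM

/-! ## §1  Faces through a prescribed CM type -/

/-- A CM field of degree `≥ 6` has three pairwise distinct infinite places, two of them different from any given one. -/
theorem exists_pair_infinitePlace_ne (F : CMField) (h6 : 6 ≤ Module.finrank ℚ F) (w₁ : InfinitePlace F) :
    ∃ w w' : InfinitePlace F, w ≠ w' ∧ w₁ ≠ w ∧ w₁ ≠ w' := by
  classical
  have hcard : 2 < Fintype.card (InfinitePlace F) := by
    have h1 := InfinitePlace.card_eq_nrRealPlaces_add_nrComplexPlaces (K := F)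
    have h2 := IsTotallyComplex.finrank (K := F)
    have h3 := IsTotallyComplex.nrRealPlaces_eq_zero (K := F)
    omega
  obtain ⟨a, b, c, hab, hac, hbc⟩ := (Fintype.two_lt_card_iff).1 hcard
  by_cases ha : w₁ = a
  · exact ⟨b, c, hbc, ha ▸ hab, ha ▸ hac⟩
  by_cases hb : w₁ = b
  · exact ⟨a, c, hac, ha, hb ▸ hbc⟩
  · exact ⟨a, b, hab, ha, hb⟩

/-- **Every CM type containing `ι₁` is slot 0 of an admissible face.**  Over a CM field with `6 ≤ [F:ℚ]` (three infinite
places), for every CM type `Φ` and every `ι₁ ∈ Φ` there is a rank-four face `f = (Φ; π, π′)` with base type `f.Φ = Φ`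
(so `f.psi 0 = Φ`) for which `ι₁` is admissible: `π ≠ π′` any two places off the place of `ι₁` (rfwf Lemma 2.1 read
backwards). -/
theorem exists_face_eq_admissible (F : CMField) (h6 : 6 ≤ Module.finrank ℚ F) (Φ : CMType F) {ι₁ : F →+* ℂ}
    (hι : ι₁ ∈ Φ.1) : ∃ f : Face F, f.Φ = Φ ∧ f.Admissible ι₁ := by
  obtain ⟨w, w', hww, hw, hw'⟩ := exists_pair_infinitePlace_ne F h6 (InfinitePlace.mk ι₁)
  refine ⟨{ Φ := Φ, p := w.embedding, p' := w'.embedding,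
            place_ne := by rwa [InfinitePlace.mk_embedding, InfinitePlace.mk_embedding] }, rfl, ?_⟩
  refine ⟨hι, ?_, ?_⟩
  · show InfinitePlace.mk ι₁ ≠ InfinitePlace.mk w.embedding
    rwa [InfinitePlace.mk_embedding]
  · show InfinitePlace.mk ι₁ ≠ InfinitePlace.mk w'.embedding
    rwa [InfinitePlace.mk_embedding]

/-! ## §2  B01-S supplies every CM type containing `ι₁` (any universe) -/

namespace Universe

variable {U : Universe}

/-- **B01-S is face-free in slot 0** (any universe, no facts): `U.FaceSupply` gives, for EVERY CM type `Φ ∋ ι₁` of a Galois CM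
field of degree `≥ 6` and every hermitian 3-space `V` at `ι₁`, a level with a non-zero class of `U_Φ(Γ)_{ι₁}` — apply B01-S to
a face through `Φ` (`exists_face_eq_admissible`) and keep slot 0. -/
theorem exists_mem_Uiso_ne_zero_of_faceSupply (h : U.FaceSupply) (F : CMField) (hG : IsGalois ℚ F)
    (h6 : 6 ≤ Module.finrank ℚ F) (Φ : CMType F) {ι₁ : F →+* ℂ} (hι : ι₁ ∈ Φ.1) (V : HermSpace3 F ι₁) :
    ∃ (Γ : Level V) (ω : U.CohC (U.pms F ι₁ V Γ) 1), ω ∈ U.Uiso Γ F Φ ι₁ ∧ ω ≠ 0 := by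
  obtain ⟨f, rfl, hf⟩ := exists_face_eq_admissible F h6 Φ hι
  obtain ⟨Γ, ω₀, ω₁, h₀, -, hne₀, -⟩ := h F hG h6 f ι₁ hf V
  exact ⟨Γ, ω₀, h₀, hne₀⟩

/-- The same at the level of morphisms (kernel, no facts): B01-S gives, for every CM type `Φ ∋ ι₁`, a morphism
`P_Γ → A_{(F,Φ)}` non-zero on `H¹(−, ℚ)` at some level (`exists_mor_pull_ne_zero_of_mem_Uiso`). -/
theorem exists_mor_pull_ne_zero_of_faceSupply (h : U.FaceSupply) (F : CMField) (hG : IsGalois ℚ F)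
    (h6 : 6 ≤ Module.finrank ℚ F) (Φ : CMType F) {ι₁ : F →+* ℂ} (hι : ι₁ ∈ Φ.1) (V : HermSpace3 F ι₁) :
    ∃ (Γ : Level V) (u : U.Mor (U.pms F ι₁ V Γ) (U.cmAV F Φ)), U.pull u 1 ≠ 0 := by
  obtain ⟨Γ, ω, hω, hne⟩ := exists_mem_Uiso_ne_zero_of_faceSupply h F hG h6 Φ hι V
  obtain ⟨u, hu⟩ := exists_mor_pull_ne_zero_of_mem_Uiso hω hne
  exact ⟨Γ, u, hu⟩

/-- **Face-free supply implies B01-S, given level-joining.**  On a universe on which two one-type supplies at independent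
levels can be brought to a common level (the right-hand side of `Model.faceSupply_iff_slotwise`), the face-free supply of
every CM type containing `ι₁` gives `FaceSupply`: both slot types `f.psi 0`, `f.psi 1` contain an admissible `ι₁`
(`admissible_mem_psi`). -/
theorem slotwise_of_typewise
    (h : ∀ (F : CMField), IsGalois ℚ F → 6 ≤ Module.finrank ℚ F →
      ∀ (Φ : CMType F) (ι₁ : F →+* ℂ), ι₁ ∈ Φ.1 → ∀ V : HermSpace3 F ι₁,
        ∃ (Γ : Level V) (ω : U.CohC (U.pms F ι₁ V Γ) 1), ω ∈ U.Uiso Γ F Φ ι₁ ∧ ω ≠ 0) :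
    ∀ (F : CMField), IsGalois ℚ F → 6 ≤ Module.finrank ℚ F →
      ∀ (f : Face F) (ι₁ : F →+* ℂ), f.Admissible ι₁ → ∀ V : HermSpace3 F ι₁,
        (∃ (Γ : Level V) (ω : U.CohC (U.pms F ι₁ V Γ) 1), ω ∈ U.Uiso Γ F (f.psi 0) ι₁ ∧ ω ≠ 0) ∧
        (∃ (Γ : Level V) (ω : U.CohC (U.pms F ι₁ V Γ) 1), ω ∈ U.Uiso Γ F (f.psi 1) ι₁ ∧ ω ≠ 0) :=
  fun F hG h6 f ι₁ hf V =>
    ⟨h F hG h6 (f.psi 0) ι₁ (admissible_mem_psi f ι₁ hf 0) V, h F hG h6 (f.psi 1) ι₁ (admissible_mem_psi f ι₁ hf 1) V⟩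

end Universe

/-! ## §3  The model universe: B01-S ⇔ face-free supply ⇔ type reach; primitive cores suffice -/

namespace Model

section Data

/-- **B01-S is face-free** on `universeOf hHD hI hU h₃` for ANY packaged uniformisation datum (definition-free):
`FaceSupply` holds iff EVERY CM type `Φ` of a Galois CM field of degree `≥ 6` containing `ι₁` has, for every hermitian 3-space
`V` at `ι₁`, some level with a non-zero class of `U_Φ(Γ)_{ι₁}` (⇒ `exists_mem_Uiso_ne_zero_of_faceSupply`; ⇐ the two slot
supplies meet at a common level, `universeOf_faceSupply_iff_slotwise`). [cite: BergeronMillsonMoeglin2016Balls, Introduction §1.1] -/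
theorem universeOf_faceSupply_iff_typewise (hHD : exists_isReal_hodgeModel) (hI : hodgePQ_independent_of_hodgeModel)
    (hU : BallQuotientUniformisedDatum) (h₃ : CMAbelianVarietyRealised) :
    (universeOf hHD hI hU h₃).FaceSupply ↔
      ∀ (F : CMField), IsGalois ℚ F → 6 ≤ Module.finrank ℚ F →
        ∀ (Φ : CMType F) (ι₁ : F →+* ℂ), ι₁ ∈ Φ.1 → ∀ V : HermSpace3 F ι₁,
          ∃ (Γ : Level V) (ω : (universeOf hHD hI hU h₃).CohC ((universeOf hHD hI hU h₃).pms F ι₁ V Γ) 1),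
            ω ∈ (universeOf hHD hI hU h₃).Uiso Γ F Φ ι₁ ∧ ω ≠ 0 := by
  constructor
  · intro hS F hG h6 Φ ι₁ hι V
    exact Universe.exists_mem_Uiso_ne_zero_of_faceSupply hS F hG h6 Φ hι V
  · intro h
    exact (universeOf_faceSupply_iff_slotwise hHD hI hU h₃).2 (Universe.slotwise_of_typewise h)

/-- **B01-S ⇔ type reach** on `universeOf hHD hI hU h₃`: `FaceSupply` holds iff for every CM type `Φ ∋ ι₁` (Galois CM field,
degree `≥ 6`) and every `V` some surface `P_Γ` of the `V`-tower admits a morphism `u : P_Γ → A_{(F,Φ)}` with `u^* ≠ 0` on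
`H¹(−, ℚ)` — no eigen-class, no isotypicity (`Universe.Uiso_ne_bot_iff` over the model rows M07/M13/M14, `modelAxioms_holds`).
[cite: Shimura1998, §6.2 Theorem 3 (pp. 41–43)] [cite: BergeronMillsonMoeglin2016Balls, Introduction §1.1] -/
theorem universeOf_faceSupply_iff_typeReach (hHD : exists_isReal_hodgeModel) (hI : hodgePQ_independent_of_hodgeModel)
    (hU : BallQuotientUniformisedDatum) (h₃ : CMAbelianVarietyRealised) :
    (universeOf hHD hI hU h₃).FaceSupply ↔
      ∀ (F : CMField), IsGalois ℚ F → 6 ≤ Module.finrank ℚ F →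
        ∀ (Φ : CMType F) (ι₁ : F →+* ℂ), ι₁ ∈ Φ.1 → ∀ V : HermSpace3 F ι₁,
          ∃ (Γ : Level V) (u : (universeOf hHD hI hU h₃).Mor ((universeOf hHD hI hU h₃).pms F ι₁ V Γ)
              ((universeOf hHD hI hU h₃).cmAV F Φ)),
            (universeOf hHD hI hU h₃).pull u 1 ≠ 0 := by
  rw [universeOf_faceSupply_iff_typewise]
  have hA := modelAxioms_holds hHD hI hU h₃
  constructor
  · intro h F hG h6 Φ ι₁ hι V
    obtain ⟨Γ, ω, hω, hne⟩ := h F hG h6 Φ ι₁ hι V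
    obtain ⟨u, hu⟩ := Universe.exists_mor_pull_ne_zero_of_mem_Uiso hω hne
    exact ⟨Γ, u, hu⟩
  · intro h F hG h6 Φ ι₁ hι V
    obtain ⟨Γ, u, hu⟩ := h F hG h6 Φ ι₁ hι V
    have hne : (universeOf hHD hI hU h₃).Uiso Γ F Φ ι₁ ≠ ⊥ :=
      (Universe.Uiso_ne_bot_iff hA.H1_rank hA.eigenLine hA.alphaLine Γ F Φ hι).2 ⟨u, hu⟩
    obtain ⟨ω, hω, hne'⟩ := (Submodule.ne_bot_iff _).1 hne
    exact ⟨Γ, ω, hω, hne'⟩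

/-- **Reaching the primitive cores suffices for B01-S** (`universeOf hHD hI hU h₃`).  Suppose that for every Galois CM field
`F` with `6 ≤ [F:ℚ]`, every `ι₁`, every hermitian 3-space `V` at `ι₁`, and every sub-pair `(K₀, Φ₀)` — `K₀` a CM field with
`k : K₀ → F`, `Φ₀` a PRIMITIVE CM type of `K₀` (embeddings of `K₀` with the same `Aut(ℂ)`-pattern on `Φ₀` coincide) with
`ι₁ ∘ k ∈ Φ₀` — some surface `P_Γ(V)` admits a morphism to `A_{(K₀,Φ₀)}` non-zero on `H¹`.  Then `FaceSupply` holds: every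
CM type `Φ ∋ ι₁` of `F` is induced from its primitive core `(K₁ ⊆ F, Φ₁)` (Streng 2010 Lemma 3.5,
`exists_primitive_inducedCMType_eq_of_isCMField`), `ι₁|_{K₁} ∈ Φ₁`, the reach of `A_{(K₁,Φ₁)}` makes `U_{(K₁,Φ₁)}(Γ)_{ι₁|K₁} ≠ 0`
(`Universe.Uiso_ne_bot_iff`), and inflation `U_{(K₁,Φ₁)}(Γ)_{ι₁|K₁} ≤ U_{(F,Φ)}(Γ)_{ι₁}` (`universeOf_uisoInflation`, Shimura §6.2
Thm. 3) gives the face-free supply of `Φ`. [cite: Streng2010, Ch. I Lemma 3.5] [cite: Shimura1998, §6.2 Theorem 3 (pp. 41–43)] -/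
theorem universeOf_faceSupply_of_primitiveReach (hHD : exists_isReal_hodgeModel) (hI : hodgePQ_independent_of_hodgeModel)
    (hU : BallQuotientUniformisedDatum) (h₃ : CMAbelianVarietyRealised)
    (h : ∀ (F : CMField), IsGalois ℚ F → 6 ≤ Module.finrank ℚ F → ∀ (ι₁ : F →+* ℂ) (V : HermSpace3 F ι₁)
      (K₀ : CMField) (k : K₀ →+* F) (Φ₀ : CMType K₀),
      (∀ s t : K₀ →+* ℂ,
        (∀ τ : ℂ ≃+* ℂ, (τ : ℂ →+* ℂ).comp s ∈ Φ₀.1 ↔ (τ : ℂ →+* ℂ).comp t ∈ Φ₀.1) → s = t) →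
      ι₁.comp k ∈ Φ₀.1 →
      ∃ (Γ : Level V) (u : (universeOf hHD hI hU h₃).Mor ((universeOf hHD hI hU h₃).pms F ι₁ V Γ)
          ((universeOf hHD hI hU h₃).cmAV K₀ Φ₀)),
        (universeOf hHD hI hU h₃).pull u 1 ≠ 0) :
    (universeOf hHD hI hU h₃).FaceSupply := by
  rw [universeOf_faceSupply_iff_typewise]
  intro F hG h6 Φ ι₁ hι V
  have hA := modelAxioms_holds hHD hI hU h₃
  -- the primitive core `(K₁ ⊆ F, Φ₁)` of `Φ` (Streng Lemma 3.5), a CM pair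
  obtain ⟨K₁, Φ₁, hK₁, hind, hprim, -⟩ := exists_primitive_inducedCMType_eq_of_isCMField (M := F) Φ
  let K₀ : CMField := @CMField.mk K₁ _ _ hK₁
  have hι₀ : ι₁.comp (algebraMap K₁ F) ∈ Φ₁.1 := by
    have hmem := mem_inducedCMType_iff (algebraMap K₁ F) Φ₁ ι₁
    rw [hind] at hmem
    exact hmem.1 hι
  -- reach of `A_{(K₁,Φ₁)}`, hence `U_{(K₁,Φ₁)}(Γ)_{ι₁|K₁} ≠ 0`
  obtain ⟨Γ, u, hu⟩ := h F hG h6 ι₁ V K₀ (algebraMap K₁ F) Φ₁ hprim hι₀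
  have hne₀ : (universeOf hHD hI hU h₃).Uiso Γ K₀ Φ₁ (ι₁.comp (algebraMap K₁ F)) ≠ ⊥ :=
    (Universe.Uiso_ne_bot_iff hA.H1_rank hA.eigenLine hA.alphaLine Γ K₀ Φ₁ hι₀).2 ⟨u, hu⟩
  -- inflation to `(F, Φ₁^F) = (F, Φ)`
  have hle : (universeOf hHD hI hU h₃).Uiso Γ K₀ Φ₁ (ι₁.comp (algebraMap K₁ F)) ≤
      (universeOf hHD hI hU h₃).Uiso Γ F Φ ι₁ := by
    have h' := universeOf_uisoInflation hHD hI hU h₃ K₀ F (algebraMap K₁ F) Φ₁ ι₁ Γ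
    rw [hind] at h'
    exact h'
  have hne : (universeOf hHD hI hU h₃).Uiso Γ F Φ ι₁ ≠ ⊥ := fun h0 => hne₀ (eq_bot_iff.2 (h0 ▸ hle))
  obtain ⟨ω, hω, hω0⟩ := (Submodule.ne_bot_iff _).1 hne
  exact ⟨Γ, ω, hω, hω0⟩

end Data

/-! ## §4  On the universe of record `picardCMUniverse hHD hI h₁ h₃` -/

section EndState

/-- **B01-S is face-free** (universe of record `U = picardCMUniverse hHD hI h₁ h₃`, definition-free):
`U.FaceSupply ↔ ∀ F Galois, 6 ≤ [F:ℚ], ∀ (Φ : CMType F) (ι₁ ∈ Φ) (V : HermSpace3 F ι₁), ∃ Γ ω, ω ∈ U.Uiso Γ F Φ ι₁ ∧ ω ≠ 0` —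
the leaf B01-S is «every CM type containing `ι₁` is supplied somewhere on the `V`-tower».
[cite: BergeronMillsonMoeglin2016Balls, Introduction §1.1] -/
theorem faceSupply_iff_typewise (hHD : exists_isReal_hodgeModel) (hI : hodgePQ_independent_of_hodgeModel)
    (h₁ : BallQuotientUniformised) (h₃ : CMAbelianVarietyRealised) :
    (picardCMUniverse hHD hI h₁ h₃).FaceSupply ↔
      ∀ (F : CMField), IsGalois ℚ F → 6 ≤ Module.finrank ℚ F →
        ∀ (Φ : CMType F) (ι₁ : F →+* ℂ), ι₁ ∈ Φ.1 → ∀ V : HermSpace3 F ι₁,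
          ∃ (Γ : Level V) (ω : (picardCMUniverse hHD hI h₁ h₃).CohC ((picardCMUniverse hHD hI h₁ h₃).pms F ι₁ V Γ) 1),
            ω ∈ (picardCMUniverse hHD hI h₁ h₃).Uiso Γ F Φ ι₁ ∧ ω ≠ 0 :=
  universeOf_faceSupply_iff_typewise hHD hI _ h₃

/-- **B01-S ⇔ type reach** (universe of record): `U.FaceSupply` iff every CM abelian variety `A_{(F,Φ)}` with `ι₁ ∈ Φ`
(`F` Galois CM, `6 ≤ [F:ℚ]`) receives, for every `V`, a morphism from SOME compact Picard modular surface `P_Γ(V)` that is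
non-zero on `H¹(−, ℚ)`. [cite: Shimura1998, §6.2 Theorem 3 (pp. 41–43)] [cite: BergeronMillsonMoeglin2016Balls, Introduction §1.1] -/
theorem faceSupply_iff_typeReach (hHD : exists_isReal_hodgeModel) (hI : hodgePQ_independent_of_hodgeModel)
    (h₁ : BallQuotientUniformised) (h₃ : CMAbelianVarietyRealised) :
    (picardCMUniverse hHD hI h₁ h₃).FaceSupply ↔
      ∀ (F : CMField), IsGalois ℚ F → 6 ≤ Module.finrank ℚ F →
        ∀ (Φ : CMType F) (ι₁ : F →+* ℂ), ι₁ ∈ Φ.1 → ∀ V : HermSpace3 F ι₁,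
          ∃ (Γ : Level V) (u : (picardCMUniverse hHD hI h₁ h₃).Mor ((picardCMUniverse hHD hI h₁ h₃).pms F ι₁ V Γ)
              ((picardCMUniverse hHD hI h₁ h₃).cmAV F Φ)),
            (picardCMUniverse hHD hI h₁ h₃).pull u 1 ≠ 0 :=
  universeOf_faceSupply_iff_typeReach hHD hI _ h₃

/-- **Reaching the primitive cores suffices for B01-S** (universe of record): if every PRIMITIVE sub-pair `(K₀ →ᵏ F, Φ₀)` with
`ι₁ ∘ k ∈ Φ₀` is reached — some `P_Γ(V) → A_{(K₀,Φ₀)}` non-zero on `H¹` — then `(picardCMUniverse hHD hI h₁ h₃).FaceSupply`.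
[cite: Streng2010, Ch. I Lemma 3.5] [cite: Shimura1998, §6.2 Theorem 3 (pp. 41–43)] -/
theorem faceSupply_of_primitiveReach (hHD : exists_isReal_hodgeModel) (hI : hodgePQ_independent_of_hodgeModel)
    (h₁ : BallQuotientUniformised) (h₃ : CMAbelianVarietyRealised)
    (h : ∀ (F : CMField), IsGalois ℚ F → 6 ≤ Module.finrank ℚ F → ∀ (ι₁ : F →+* ℂ) (V : HermSpace3 F ι₁)
      (K₀ : CMField) (k : K₀ →+* F) (Φ₀ : CMType K₀),
      (∀ s t : K₀ →+* ℂ,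
        (∀ τ : ℂ ≃+* ℂ, (τ : ℂ →+* ℂ).comp s ∈ Φ₀.1 ↔ (τ : ℂ →+* ℂ).comp t ∈ Φ₀.1) → s = t) →
      ι₁.comp k ∈ Φ₀.1 →
      ∃ (Γ : Level V) (u : (picardCMUniverse hHD hI h₁ h₃).Mor ((picardCMUniverse hHD hI h₁ h₃).pms F ι₁ V Γ)
          ((picardCMUniverse hHD hI h₁ h₃).cmAV K₀ Φ₀)),
        (picardCMUniverse hHD hI h₁ h₃).pull u 1 ≠ 0) :
    (picardCMUniverse hHD hI h₁ h₃).FaceSupply :=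
  universeOf_faceSupply_of_primitiveReach hHD hI _ h₃ h

/-- The closed instance: on the model universe OF RECORD (all four data tree theorems), whose `FaceSupply` is the displayed leaf
B01-S of `Model.perLFace_closed_of_supply_heckeWedge10_overlap`, B01-S ⇔ type reach.
[cite: BergeronMillsonMoeglin2016Balls, Introduction §1.1] -/
theorem faceSupply_closed_iff_typeReach :
    (picardCMUniverse exists_isReal_hodgeModel_holds hodgePQ_independent_of_hodgeModel_holds
        BallQuotient.ballQuotientUniformised_holds cmAbelianVarietyRealised_holds).FaceSupply ↔
      ∀ (F : CMField), IsGalois ℚ F → 6 ≤ Module.finrank ℚ F →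
        ∀ (Φ : CMType F) (ι₁ : F →+* ℂ), ι₁ ∈ Φ.1 → ∀ V : HermSpace3 F ι₁,
          ∃ (Γ : Level V) (u : (picardCMUniverse exists_isReal_hodgeModel_holds hodgePQ_independent_of_hodgeModel_holds
              BallQuotient.ballQuotientUniformised_holds cmAbelianVarietyRealised_holds).Mor
              ((picardCMUniverse exists_isReal_hodgeModel_holds hodgePQ_independent_of_hodgeModel_holds
                BallQuotient.ballQuotientUniformised_holds cmAbelianVarietyRealised_holds).pms F ι₁ V Γ)
              ((picardCMUniverse exists_isReal_hodgeModel_holds hodgePQ_independent_of_hodgeModel_holds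
                BallQuotient.ballQuotientUniformised_holds cmAbelianVarietyRealised_holds).cmAV F Φ)),
            (picardCMUniverse exists_isReal_hodgeModel_holds hodgePQ_independent_of_hodgeModel_holds
              BallQuotient.ballQuotientUniformised_holds cmAbelianVarietyRealised_holds).pull u 1 ≠ 0 :=
  faceSupply_iff_typeReach _ _ _ _

end EndState

end Model

end Summit.HodgeConjecture.CorCM

end
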